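import Literature.AlgebraicGeometry.Resolution.ProjectiveStrongResolution
import Literature.AlgebraicGeometry.Resolution.IdealSheafLemmas
import Literature.AlgebraicGeometry.Resolution.GenericFibreResolutionDatum
import HarnessLib

/-!
# [OURS · L1 W4.5(b) · EL♮(3) · NOSE, N-2 (d) Part B] THE AFFINE CHART OF A CLOSED SUBSCHEME OVER AN AMBIENT AFFINE CHART — `Spec (A ⧸ p) ⟶ Z` and the
# bookkeeping of ideal sheaves along it (generic; the second input of the chart-atlas frame)

res-L1-w45b-nose-w2 g2 (WIDTH seat on D-0157 DOOR 1; self-dealt under the desk's N-2 GO). OURS; NOT a statement of any manuscript ([Hironaka2017] is a candidate under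
adjudication, nothing of it is asserted); AI-written, weaker than expert review. No `sorry`; standard axioms; DEF-FREE; Literature-only imports.
`--kind proof --supports stmt-ResolutionOfSingularities-20148 --as helper`; closes nothing. Resolution of singularities in positive characteristic is NOT proved here or
anywhere in this chain (dimension 3 is Cossart–Piltant 2008/2009 in print); EL♮(3) is NOT proved by this file.

WHAT. For a closed immersion `ι : Z ⟶ X` of a REDUCED scheme, an open immersion `c : Spec A ⟶ X` and an ideal `p ⊆ A` with `ι.ker · 𝒪_{Spec A} = p~`
(`ι.ker.comap c = affineBlowup.idealSheaf p`): ★ `exists_openImmersion_specQuotient` — there is an OPEN IMMERSION `c' : Spec (A ⧸ p) ⟶ Z` with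
`c' ≫ ι = Spec (A → A⧸p) ≫ c` whose image is all of `Z` over `range c` (the construction inside the tree's ✓ `isRegularLocalRing_localization_quotient_of_chart`,
Literature `ProjectiveStrongResolution`, exported: `Spec (A ⧸ p)` is a surjective closed immersion into the reduced `Z ×_X Spec A`, hence an isomorphism); and
`comap_comap_of_chart` — for any ideal sheaf `K` on `X` with `K.comap c = (I)~`, the pulled-back centre on the chart is `((K.comap ι).comap c') = (I·(A⧸p))~`.
These are the two generic inputs (chart + centre) of a packet of the chart-atlas frame ✓ `isRegular_of_isBlowup_of_chartAtlas` (…NatBlowupRegularOfChartAtlas) when the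
base of the blow-up is a reduced closed subscheme `Z ↪ X` known through the ambient charts of `X` — e.g. the reduced strict transform `St~ ⊂ Bl_P ℙ³` of the Roman surface
(packet 0 Part A ✓/⊙ `…NatSpecimenSteinerStrictChart0`).
-/

set_option linter.dupNamespace false -- mandated namespace `Summit.<Summit>.<Problem>` of this single-conjunct summit

noncomputable section

open CategoryTheory CategoryTheory.Limits AlgebraicGeometry TopologicalSpace
open Literature.AlgebraicGeometry.Resolution
open AlgebraicGeometry.Scheme.IdealSheafData

namespace Summit.ResolutionOfSingularities.ResolutionOfSingularities.Cruxes.EquisingularLiftNat.Sections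

universe u

/-- ★ **THE AFFINE CHART OF A CLOSED SUBSCHEME OVER AN AMBIENT AFFINE CHART.** `ι : Z ⟶ X` a closed immersion with `Z` reduced, `c : Spec A ⟶ X` an open immersion,
`p ⊆ A` with `ι.ker.comap c = p~`. Then there is an open immersion `c' : Spec (A ⧸ p) ⟶ Z` with `c' ≫ ι = Spec(A → A⧸p) ≫ c`, and every point of `Z` lying over
`range c` is in `range c'`. (`Spec (A⧸p) → Z ×_X Spec A` is a surjective closed immersion into a reduced scheme, hence an isomorphism; `Z ×_X Spec A → Z` is an open
immersion.) [folklore; cite: StacksProject, Tag 01QN] -/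
theorem exists_openImmersion_specQuotient {A : Type u} [CommRing A] {Z X : Scheme.{u}} [IsReduced Z] (ι : Z ⟶ X) [IsClosedImmersion ι]
    (c : Spec (CommRingCat.of A) ⟶ X) [IsOpenImmersion c] (p : Ideal A) (hIc : ι.ker.comap c = affineBlowup.idealSheaf p) :
    ∃ (c' : Spec (CommRingCat.of (A ⧸ p)) ⟶ Z) (_ : IsOpenImmersion c'),
      c' ≫ ι = Spec.map (CommRingCat.ofHom (Ideal.Quotient.mk p)) ≫ c ∧
      ∀ z : Z, ι z ∈ Set.range c → z ∈ Set.range c' := by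
  classical
  set q : Spec (CommRingCat.of (A ⧸ p)) ⟶ Spec (CommRingCat.of A) := Spec.map (CommRingCat.ofHom (Ideal.Quotient.mk p)) with hqdef
  haveI : IsClosedImmersion q := IsClosedImmersion.spec_of_surjective _ Ideal.Quotient.mk_surjective
  have hqker : q.ker = affineBlowup.idealSheaf p := ker_specMap_quotient_mk p
  let p₁ := pullback.fst ι c
  let p₂ := pullback.snd ι c
  haveI : IsReduced (pullback ι c) := isReduced_of_isOpenImmersion p₁
  have hker : ι.ker ≤ (q ≫ c).ker := by
    rw [Scheme.Hom.ker_comp, Scheme.IdealSheafData.le_map_iff_comap_le, hIc, hqker]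
  let ψ : Spec (CommRingCat.of (A ⧸ p)) ⟶ Z := IsClosedImmersion.lift ι (q ≫ c) hker
  have hψ : ψ ≫ ι = q ≫ c := IsClosedImmersion.lift_fac ι (q ≫ c) hker
  let a : Spec (CommRingCat.of (A ⧸ p)) ⟶ pullback ι c := pullback.lift ψ q hψ
  have ha₁ : a ≫ p₁ = ψ := pullback.lift_fst _ _ _
  have ha₂ : a ≫ p₂ = q := pullback.lift_snd _ _ _
  haveI : IsClosedImmersion a := by
    have : IsClosedImmersion (a ≫ p₂) := by rw [ha₂]; infer_instance
    exact MorphismProperty.of_postcomp (W := @IsClosedImmersion) (W' := @IsSeparated) a p₂ inferInstance this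
  have hrangeq : Set.range q = PrimeSpectrum.zeroLocus (p : Set A) := by
    rw [← coe_support_ker_of_isClosedImmersion q, hqker, affineBlowup.support_idealSheaf]
  have hrange₂ : Set.range p₂ ⊆ Set.range q := by
    rw [Scheme.Pullback.range_snd, hrangeq, ← affineBlowup.support_idealSheaf, ← hIc, Scheme.IdealSheafData.support_comap,
      TopologicalSpace.Closeds.coe_preimage, coe_support_ker_of_isClosedImmersion ι]
  haveI : Surjective a := by
    refine ⟨fun t => ?_⟩
    obtain ⟨y, hy⟩ := hrange₂ ⟨t, rfl⟩
    refine ⟨y, p₂.isClosedEmbedding.injective ?_⟩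
    rw [← Scheme.Hom.comp_apply, ha₂, hy]
  haveI : IsIso a := isIso_of_isClosedImmersion_of_surjective a
  haveI : IsOpenImmersion ψ := by rw [← ha₁]; infer_instance
  refine ⟨ψ, inferInstance, hψ, fun z hz => ?_⟩
  obtain ⟨y, hy⟩ := hz
  obtain ⟨t, ht₁, -⟩ := Scheme.Pullback.exists_preimage_pullback (f := ι) (g := c) z y hy.symm
  refine ⟨(inv a) t, ?_⟩
  have hat : a ((inv a) t) = t := by
    rw [← Scheme.Hom.comp_apply, IsIso.inv_hom_id]; rfl
  rw [← ha₁, Scheme.Hom.comp_apply, hat]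
  exact ht₁

/-- **Centre bookkeeping along the chart.** With `c' ≫ ι = Spec(A → A⧸p) ≫ c` and an ideal sheaf `K` on `X` whose pull-back to the ambient chart is `I~`
(`K.comap c = affineBlowup.idealSheaf I`), the centre `K·𝒪_Z` pulled back to the chart `Spec (A⧸p)` is `(I·(A⧸p))~`. [folklore] -/
theorem comap_comap_of_chart {A : Type u} [CommRing A] {Z X : Scheme.{u}} (ι : Z ⟶ X) (c : Spec (CommRingCat.of A) ⟶ X) (p : Ideal A)
    (c' : Spec (CommRingCat.of (A ⧸ p)) ⟶ Z) (hc' : c' ≫ ι = Spec.map (CommRingCat.ofHom (Ideal.Quotient.mk p)) ≫ c)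
    (K : X.IdealSheafData) (I : Ideal A) (hK : K.comap c = affineBlowup.idealSheaf I) :
    (K.comap ι).comap c' = affineBlowup.idealSheaf (I.map (Ideal.Quotient.mk p)) := by
  rw [← Scheme.IdealSheafData.comap_comp, hc', Scheme.IdealSheafData.comap_comp, hK]
  exact affineBlowup.comap_idealSheaf_specMap (Ideal.Quotient.mk p) I

end Summit.ResolutionOfSingularities.ResolutionOfSingularities.Cruxes.EquisingularLiftNat.Sections

end
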